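import Summits.BirchSwinnertonDyer.BirchSwinnertonDyer.Theorems.ClassRecordThreeEulerHalvesAtThreeJetchev
import Summits.BirchSwinnertonDyer.BirchSwinnertonDyer.Theorems.ErratumRoadFiveNonSurjCornerTamagawaCarriers
import Summits.BirchSwinnertonDyer.Rank1Residual.X11b.BDPRouteNoRam
import Summits.BirchSwinnertonDyer.Rank1Residual.AdditivePotMult.RankOneHeegner
import Literature.NumberTheory.EllipticCurves.Wuthrich2014.ThreeAdicImageOrdinaryProofs
import Literature.NumberTheory.EllipticCurves.PAdicBSDSplitMultiplicativeProofs
import Literature.NumberTheory.EllipticCurves.TamagawaPrimesEquivProofs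
import HarnessLib

/-!
# Route `ErratumRoadFive` (K2, `p ≥ 5`), crux `EulerHalfNotRamNoInertSetAtFive` (item stmt-BirchSwinnertonDyer-19715):
# the CONSUMER of «Jetchev at the multiplicative prime p itself» in the HL ∕ `PDiv` currency of the p = 3 kernel chain,
# PORTED from `3` to a general odd prime `p` — the Euler-system half on MONO-CARRIER ¬(ram) ∧ surj X11b pairs, and the
# line's residual S1b («p the only multiplicative prime, split, `p ∣ ord_p Δ_min`»), from ONE displayed binder `hJmax`
# (cell `bsd-stepL`, lead seat `bsd-line-er5-p1` g0; `--supports stmt-BirchSwinnertonDyer-19715 --as helper`; RULING 52 port, TOP of the chain)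

WHAT. Planner RULING 52 (2026-08-28): the line of attack for 19715's deciding stub is the PORT to `p ≥ 5` of tam3-p1's kernel chain at
`p = 3` (`Koly.jetchevMaxHLAtThree_of_facts_of_print`, p547155, + `…EulerHalvesAtThreeJetchevMax` §1–§2). This file ports the TOP of that
chain — the consumer — so that the port's deliverable can be stated EXACTLY: the binder `hJmax` below is tam3-p1's `JetchevMaxHL`
(`…EulerHalvesAtThreeJetchevMax.lean`, binder of the same name) with `3 ↦ p` and nothing else (Jetchev 2008 Thm. 1.4 «`m_∞ ≥ max_q ord_p c_q`»
read at `p ∥ N`: on every Manin-good conductor-1 odd Heegner frame of a curve with `r_an = 1`, multiplicative at `p`, `ρ̄_{E,p}` onto, the derived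
Heegner classes are `p^s`-divisible for every finite place `v`, every `s ≤ ord_p c_v(E)` — `v = (p)` NOT excluded — at Kolyvagin levels of index `≥ s`).
* §1 `shaIndexBound_sharp_of_globalDivisibility` — tam3-p1's `shaIndexBound_sharp_three_of_globalDivisibility` (…Jetchev.lean §1) at a general odd
  `p`: global divisibility to depth `t` on one conductor-1 frame + McCallum Cor. 5.6 upper form (`hMcU`) ⟹ `ord_p #Ш(E∕K) + 2t ≤ 2·ord_p [E(K):ℤP]`
  (tower surjectivity at a multiplicative `p` from `ρ̄` onto by Wuthrich 2014 Lemma 20 = `forall_hasSurjectiveModNGaloisRep_pow_of_multiplicative_of_surj`).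
* §2 the odd Manin-good Heegner frame with `d_K < −4` (x11b3 ∕ imc-p1's `X11b.exists_oddHeegnerData_discr_lt`; re-derived inline in §3): at
  `p ≥ 5` the bound is what gives `d_K ∉ {−3, −4}` (`w_K = 2`), which at `p = 3` came for free from `3 ∤ d_K`.
* §3 `missingUpperBoundAt_of_classX11b_of_surj_of_not_ram_of_monoCarrier_of_jetchevMaxHL_of_lowerX11a` — tam3-p1's
  `missingUpperBoundAt_three_of_classX11b_of_surj_of_monoCarrier_of_jetchevMaxHL_of_twistLower` (¬(ram) ∧ surj clause) at a general odd `p`,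
  with TL₃ replaced by the X11a LOWER HALF at `p` on the twist (`X11b.classX11a_twist_of_not_ram` + `exists_printShape_lower_of_missingLowerBoundAt_rankZero`).
* §4 `res_pOnlyMultCarrierAtFive_of_jetchevMaxHL_of_lowerX11a` — the line's residual S1b (registered text of `Lines/birth.lean` v2b′∕v4, binders
  verbatim) from §3: when `p ≥ 5` is the ONLY multiplicative prime the place of `p` is the unique split place, hence carries all of `ord_p ∏c`
  (corner-p1's `CornerLocal.padicValNat_tamagawaNumberAt_eq_of_unique_split`).
So: S1b ⟸ {ten PUBLISHED named facts (hGZ hKo hGZK hmod hnf hHL hMaz; hrec hD36 Literature THEOREMS; hMcU McCallum), `X11aLowerHalf` at p, `hJmax`(p)}.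
The remaining port (RULING 52) is `hJmax`(p) ⟸ the six printed facts of p547155 — files `…KolyvaginRedefinition` … `…WalkSupplyAtThreeDisplayPrint` at `3 ↦ p`.

HONEST FRAMING: THEOREMS ONLY (no definition, no named fact, no `sorry`), Theses-free; CONDITIONAL on every displayed binder, among them `hJmax`
(Jetchev at `p ∥ N`: NOT in print; its `p = 3` twin is a kernel theorem modulo six printed facts) and the X11a lower half (open crux 19064); McCallum's
fact carries the tower-surjectivity binder (supplied here) and the flag `Kolyvagin1991-LNM1479-primary-unread` (inherited); nothing is booked; 19715 is
NOT closed; BSD is proved for no pair; no summit statement is touched. Credit: tam3-p1 (the p = 3 originals, copied modulo `3 ↦ p`), x11b3, corner-p1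
(`CornerLocal`), -w2 (road J). -- adapted from Summits/BirchSwinnertonDyer/BirchSwinnertonDyer/Theorems/ClassRecordThreeEulerHalvesAtThreeJetchev{,NotRam,Max}.lean
References (locators only): [cite: McCallumLMS1991, §5 Lemma 5.1, Thm. 5.4, Cor. 5.6 (pp. 303–310)] [cite: Jetchev2008, Thm. 1.4, Cor. 1.5 (p. 812)]
[cite: GrossLMS1991, §4 (4.1), Prop. 6.2] [cite: Darmon2004, Thm. 3.6] [cite: Wuthrich2014, Lemma 20 (p. 399)] [cite: JetchevSkinnerWan2017, §7.4.2]
[cite: SilvermanATAEC1994, Cor. IV.9.2 (d)] [cite: Miller2011LMS, Def. 1.1].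
-/

set_option autoImplicit false
set_option linter.dupNamespace false

noncomputable section

open scoped Classical

namespace Summit.BirchSwinnertonDyer.BirchSwinnertonDyer.Theorems.JetchevMaxHLAtP

open WeierstrassCurve NumberField IsDedekindDomain Rat.HeightOneSpectrum
  Literature.NumberTheory.EllipticCurves
  Literature.NumberTheory.EllipticCurves.ModularForms
  Literature.NumberTheory.EllipticCurves.Rank1Residual
  Literature.NumberTheory.EllipticCurves.Rank1Residual.Typed
  Summit.BirchSwinnertonDyer.Rank1Residual Summit.BirchSwinnertonDyer.Rank1Residual.X11b
  Summit.BirchSwinnertonDyer.Rank1Residual.X11b.Three.Koly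

/-! ### §1 One frame: global divisibility + McCallum's upper form ⇒ the sharpened bound over `K` (any odd `p`) -/

/-- **The Tamagawa-sharpened Kolyvagin bound over `K` from global divisibility, at a general odd prime `p`** — tam3-p1's
`shaIndexBound_sharp_three_of_globalDivisibility` with `3 ↦ p`: `W/ℚ` globally minimal, multiplicative at `p` with `ρ̄_{E,p}` onto (so the whole
tower is onto, Wuthrich 2014 Lemma 20; non-CM), `K` imaginary quadratic Heegner for `N_E` with `d_K ∉ {−3,−4}`, a conductor-1 Kolyvagin–Heegner datum
`d₁` on `(Dt, β, ι)` with derived point `P` of infinite order, rank one, no `p`-torsion, `Ш(E∕K)` finite: global `p^s`-divisibility of the derived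
points to depth `t` (`hglob`) + McCallum Cor. 5.6 upper form (`hMcU`) ⟹ `ord_p #Ш(E∕K) + 2t ≤ 2·ord_p [E(K):ℤP]`. CONDITIONAL on `hMcU`.
[cite: McCallumLMS1991, §5 Lemma 5.1, Cor. 5.6 (pp. 303, 310)] [cite: Wuthrich2014, Lemma 20 (p. 399)] -/
theorem shaIndexBound_sharp_of_globalDivisibility
    (hMcU : McCallum1991_padicValNat_card_sha_primary_add_le_of_globalDivisibility)
    (W : WeierstrassCurve ℚ) [W.IsElliptic] [W.IsGloballyMinimal] [NeZero (W.conductorNorm ℤ)]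
    (p : ℕ) [Fact p.Prime] (hp2 : p ≠ 2)
    (K : Type) [Field K] [NumberField K]
    (hmult : W.HasMultiplicativeReductionAtPrime p) (hρ : Surj W p)
    (hK : IsImaginaryQuadratic K) (h3 : NumberField.discr K ≠ -3) (h4 : NumberField.discr K ≠ -4)
    (hHN : SatisfiesHeegnerHypothesis (W.conductorNorm ℤ) K)
    (Dt : ModularParametrizationData W (W.conductorNorm ℤ)) (β : ℤ) (ι : K →+* ℂ)
    (d₁ : KolyvaginHeegnerData Dt β ι 1) (P : (W.baseChange K).toAffine.Point)
    (hPd : d₁.toGeomPoints d₁.derivedPoint = toGeomPoints (W.baseChange K) P)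
    (hPinf : ¬ IsOfFinAddOrder P)
    (hrank : (W.baseChange K).mordellWeilRank = 1)
    (hiv : ∀ x : (W.baseChange K).toAffine.Point, p • x = 0 → x = 0)
    [Finite (W.baseChange K).sha] {t : ℕ}
    (hglob : ∀ (s : ℕ), s ≤ t → ∀ (n : ℕ) (d : KolyvaginHeegnerData Dt β ι n), Squarefree n →
      (∀ ℓ ∈ n.primeFactors, Zhang2014.IsKolyvaginPrime (W.conductorNorm ℤ) W K p ℓ ∧
        s ≤ Zhang2014.kolyvaginIndex W p ℓ) → PDiv d p s) :
    padicValNat p (Nat.card (W.baseChange K).sha) + 2 * t ≤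
      2 * padicValNat p (AddSubgroup.zmultiples P).index := by
  have hp : p.Prime := Fact.out
  -- tower surjectivity at a multiplicative `p` from `ρ̄` onto (Wuthrich 2014 Lemma 20) and no CM
  have hsurj : ∀ m : ℕ, W.HasSurjectiveModNGaloisRep (p ^ m : ℕ) :=
    forall_hasSurjectiveModNGaloisRep_pow_of_multiplicative_of_surj W p hp2 hmult hρ
  have hCM : ¬ W.HasCM := not_hasCM_of_hasMultiplicativeReductionAtPrime' W hmult
  -- the exponent p^{M₀} ∥ P (Mordell–Weil)
  haveI : Module.Finite ℤ (W.baseChange K).toAffine.Point := (W.baseChange K).module_finite_point_holds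
  obtain ⟨M₀, x₀, hx₀, hmax⟩ := exists_pow_smul_eq_and_forall_ne hPinf (p := p) hp.one_lt
  have hdiv : ∃ Q : (W.baseChange K).toAffine.Point, ((p ^ M₀ : ℕ) : ℤ) • Q = P :=
    ⟨x₀, by rw [natCast_zsmul]; exact hx₀⟩
  have hndiv : ¬ ∃ Q : (W.baseChange K).toAffine.Point, ((p ^ (M₀ + 1) : ℕ) : ℤ) • Q = P := by
    rintro ⟨Q, hQ⟩
    exact hmax Q (by rw [← natCast_zsmul]; exact hQ)
  -- McCallum's Cor. 5.6, upper form
  have hle : padicValNat p (Nat.card (AddCommGroup.primaryComponent (W.baseChange K).sha p)) + 2 * t ≤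
      2 * M₀ :=
    hMcU W hCM K hK h3 h4 hHN p hp2 hsurj Dt β ι d₁ P hPd hPinf M₀ hdiv hndiv t
      (fun s hs n d hn hℓ ↦ hglob s hs n d hn hℓ)
  have hsha : padicValNat p (Nat.card (AddCommGroup.primaryComponent (W.baseChange K).sha p)) =
      padicValNat p (Nat.card (W.baseChange K).sha) :=
    padicValNat_card_addPrimaryComponent (A := (W.baseChange K).sha) p
  haveI : Finite (AddCommGroup.torsion (W.baseChange K).toAffine.Point) :=
    WeierstrassCurve.finite_torsion_point (W := W.baseChange K)
  obtain ⟨c, Q, hcQ, hcker⟩ := RankOne.exists_coord_of_mordellWeilRank_eq_one (W.baseChange K) hrank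
  have hidx : padicValNat p (AddSubgroup.zmultiples P).index = M₀ :=
    padicValNat_index_zmultiples_eq_of_divisibility c Q hcQ hcker hiv P hdiv hndiv
  rw [hidx, ← hsha]
  exact hle

/-! ### §2 (frame) The odd Manin-good Heegner frame with `d_K < −4` is x11b3 ∕ imc-p1's `X11b.exists_oddHeegnerData_discr_lt`
(`Theorems/ErratumRoadFiveKolyvaginKernelHLFive.lean`); §3 re-derives it inline from `exists_admissibleField_of_rootNumber_eq_neg_one` +
`exists_maninDatum_of_odd` to stay light on imports. -/

/-! ### §3 Class level at a general odd `p`: ¬(ram) ∧ surj ∧ MONO-carrier, from `JetchevMaxHL`(p) + the X11a lower half -/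

/-- **The Euler-system half on MONO-CARRIER ¬(ram) ∧ surj X11b pairs at an odd prime `p`, from ONE displayed binder `hJmax` (Jetchev 2008
Thm. 1.4 read at `p ∥ N`, the `3 ↦ p` copy of tam3-p1's `JetchevMaxHL`) and the X11a lower half at `p`** — tam3-p1's
`missingUpperBoundAt_three_of_classX11b_of_surj_of_monoCarrier_of_jetchevMaxHL_of_twistLower` at a general odd `p`, its TL₃ binder replaced by the X11a
LOWER HALF on the twist (the twist by the odd Heegner field is an X11a pair: `X11b.classX11a_twist_of_not_ram`; print shape by
`exists_printShape_lower_of_missingLowerBoundAt_rankZero`). Mechanism: the odd Manin-good Hoffstein–Luo frame (§2), the conductor-1 datum with bottom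
point `y_K` (Darmon ∕ Shimura reciprocity, Literature THEOREMS passed as `hrec`, `hD36`), `hJmax` at the carrier `v` to depth `ord_p ∏c`, §1, the
twist transports, x11b3's descent `missingUpperBoundAt_of_shaIndexBound_sharp`. CONDITIONAL on every binder (`hJmax` NOT in print at `p ∣ N`;
`hX11a` = open crux `X11aLowerHalf`); nothing booked. [cite: Jetchev2008, Thm. 1.4, Cor. 1.5 (p. 812)] [cite: McCallumLMS1991, §5 Cor. 5.6 (p. 310)]
[cite: JetchevSkinnerWan2017, §7.4.2 (p. 31)] [cite: Darmon2004, Thm. 3.6] [cite: Miller2011LMS, Def. 1.1] -/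
theorem missingUpperBoundAt_of_classX11b_of_surj_of_not_ram_of_monoCarrier_of_jetchevMaxHL_of_lowerX11a
    -- published named facts
    (hGZ : ∀ (N : ℕ) [NeZero N] (W : WeierstrassCurve ℚ) (K : Type) [Field K] [NumberField K],
      gross_zagier N W K)
    (hKo : ∀ (N : ℕ) [NeZero N] (W : WeierstrassCurve ℚ) (K : Type) [Field K] [NumberField K],
      kolyvagin N W K)
    (hGZK : rank_eq_analyticRank_of_analyticRank_le_one) (hmod : hasEntireLFunction_rat)
    (hnf : exists_isNewformOf) (hHL : HoffsteinLuo1997_exists_twist_L_one_ne_zero)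
    (hMaz : mazur_not_dvd_maninConstant_of_odd)
    (hrec : ∀ (N : ℕ) [NeZero N] (W : WeierstrassCurve ℚ) (K : Type) [Field K] [NumberField K],
      heegnerPointOfConductor_one_galoisConj N W K)
    (hD36 : ∀ (N : ℕ) [NeZero N] (W : WeierstrassCurve ℚ) (K : Type) [Field K] [NumberField K],
      phi_heegnerTau_mem_singularModuliField N W K)
    (hMcU : McCallum1991_padicValNat_card_sha_primary_add_le_of_globalDivisibility)
    (p : ℕ) [Fact p.Prime] (hp2 : p ≠ 2)
    -- OPEN INPUT `JetchevMaxHL`(p): Jetchev 2008 Thm. 1.4 «m_∞ ≥ max_q ord_p c_q» READ at p ∥ N on odd Manin-good conductor-1 frames,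
    -- EVERY carrier place v (v = (p) included): tam3-p1's `hJmax` with 3 ↦ p (the PORT target of RULING 52)
    (hJmax : ∀ (W : WeierstrassCurve ℚ) [W.IsElliptic] [W.IsGloballyMinimal] [NeZero (W.conductorNorm ℤ)]
      (K : Type) [Field K] [NumberField K]
      (Dt : ModularParametrizationData W (W.conductorNorm ℤ)) (β : ℤ) (ι : K →+* ℂ),
      W.analyticRank = 1 → W.HasMultiplicativeReductionAtPrime p → Surj W p →
      IsImaginaryQuadratic K → SatisfiesHeegnerHypothesis (W.conductorNorm ℤ) K →
      Odd (NumberField.discr K) → NumberField.discr K < -4 →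
      (W.quadraticTwist (NumberField.discr K : ℚ)).entireLFunction 1 ≠ 0 →
      (4 * (W.conductorNorm ℤ : ℤ)) ∣ β ^ 2 - NumberField.discr K → ¬ (p : ℤ) ∣ Dt.c →
      ∀ (v : HeightOneSpectrum (𝓞 ℚ)) (s : ℕ), s ≤ padicValNat p (W.tamagawaNumberAt v) →
        ∀ (n : ℕ) (d : KolyvaginHeegnerData Dt β ι n), Squarefree n →
          (∀ ℓ ∈ n.primeFactors, Zhang2014.IsKolyvaginPrime (W.conductorNorm ℤ) W K p ℓ ∧
            s ≤ Zhang2014.kolyvaginIndex W p ℓ) → PDiv d p s)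
    -- the X11a lower half at p (crux `X11aLowerHalf`, binder h₃ of the route's `closes`)
    (hX11a : ∀ (Wd : WeierstrassCurve ℚ) [Wd.IsElliptic] [Wd.IsGloballyMinimal],
      ClassX11a Wd p → Typed.MissingLowerBoundAt Wd p)
    -- the pair
    (W : WeierstrassCurve ℚ) [W.IsElliptic] [W.IsGloballyMinimal]
    (hX : ClassX11b W p) (hρ : Surj W p) (hnram : ¬ Ram W p)
    (hmono : ∃ v : HeightOneSpectrum (𝓞 ℚ),
      padicValNat p W.tamagawaProduct ≤ padicValNat p (W.tamagawaNumberAt v)) :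
    Typed.MissingUpperBoundAt W p := by
  have hp : p.Prime := Fact.out
  haveI : NeZero (W.conductorNorm ℤ) := ⟨(W.conductorNorm_pos_holds).ne'⟩
  obtain ⟨hr, -, hmult, hirr⟩ := id hX
  obtain ⟨v, hv⟩ := hmono
  -- ONE odd Heegner datum with a Manin-good frame (Hoffstein–Luo field with d_K < −4; Mazur; w_K = 2)
  -- (inline `X11b.exists_oddHeegnerData` with `d_K < −4` kept: Hoffstein–Luo field, Manin-good datum, minimal model of the twist)
  have hw : W.rootNumber = -1 := by
    rw [WeierstrassCurve.rootNumber_eq_neg_one_pow_analyticRank_of_exists_isNewformOf hnf W, hr]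
    norm_num
  obtain ⟨K, _, _, hK, hodd, hlt, hHN, hHp, hLt⟩ :=
    exists_admissibleField_of_rootNumber_eq_neg_one hnf hHL W hw p
  have hpd : ¬ (p : ℤ) ∣ NumberField.discr K := not_dvd_discr_of_split hK hp hp2 hHp
  have hμ : ¬ p ∣ Units.torsionOrder K := by
    haveI : IsTotallyComplex K := hK.2
    rw [Literature.NumberTheory.DiophantineGeometry.torsionOrder_eq_two_of_discr_lt hK.1 hlt]
    intro h2
    have := Nat.le_of_dvd two_pos h2
    have := hp.two_le
    omega
  obtain ⟨Dt, H, ι, P, hP, hc⟩ :=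
    exists_maninDatum_of_odd hnf hMaz integral_neronScaling_of_isGloballyMinimal_holds W p (W.conductorNorm ℤ)
      K rfl hp2 hmult hirr hK hHN
  have hD0' : (NumberField.discr K : ℚ) ≠ 0 := by exact_mod_cast NumberField.discr_ne_zero K
  haveI hEt' : (W.quadraticTwist (NumberField.discr K : ℚ)).IsElliptic := W.isElliptic_quadraticTwist hD0'
  obtain ⟨Cd, hCd⟩ := hasGlobalMinimalModel_rat_holds (W.quadraticTwist (NumberField.discr K : ℚ))
  set Wd : WeierstrassCurve ℚ := Cd • W.quadraticTwist (NumberField.discr K : ℚ) with hWd_def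
  haveI : Wd.IsGloballyMinimal := hCd
  have hWd : Cd • W.quadraticTwist (NumberField.discr K : ℚ) = Wd := rfl
  have h3 : NumberField.discr K ≠ -3 := by omega
  have h4 : NumberField.discr K ≠ -4 := by omega
  -- a conductor-1 Kolyvagin–Heegner datum on the frame (Dt, H.β, ι), with bottom point y_K = P
  obtain ⟨d₁⟩ := exists_kolyvaginHeegnerData_one (hD36 _ W K) hK Dt H.β ι H.dvd_sq_sub
  have hPd : d₁.toGeomPoints d₁.derivedPoint = toGeomPoints (W.baseChange K) P :=
    KolyvaginBottom.toGeomPoints_derivedPoint_one_eq (hrec _ W K) hK hHN hP d₁ rfl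
  -- global divisibility to depth ord_p ∏c on this frame: the max binder at the carrier v
  have hJW : ∀ (s : ℕ), s ≤ padicValNat p W.tamagawaProduct →
      ∀ (n : ℕ) (d : KolyvaginHeegnerData Dt H.β ι n), Squarefree n →
        (∀ ℓ ∈ n.primeFactors, Zhang2014.IsKolyvaginPrime (W.conductorNorm ℤ) W K p ℓ ∧
          s ≤ Zhang2014.kolyvaginIndex W p ℓ) → PDiv d p s :=
    fun s hs n d hn hℓ ↦ hJmax W K Dt H.β ι hr hmult hρ hK hHN hodd hlt hLt H.dvd_sq_sub hc v s
      (hs.trans hv) n d hn hℓ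
  -- the sharpened bound over K at this datum, from the divisibility + McCallum (§1)
  have hU : Finite (W.baseChange K).sha → ¬ IsOfFinAddOrder P →
      padicValNat p (Nat.card (W.baseChange K).sha) + 2 * padicValNat p W.tamagawaProduct ≤
        2 * padicValNat p (AddSubgroup.zmultiples P).index := by
    intro hfin hPinf
    haveI : Finite (W.baseChange K).sha := hfin
    obtain ⟨hrank, -⟩ := hKo (W.conductorNorm ℤ) W K hK hHN ⟨Dt, H, ι, hP⟩ hPinf
    have hbot := torsionBy_eq_bot_of_isImaginaryQuadratic_of_hasIrreducibleModPGaloisRep W K hK hp hirr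
    have hiv : ∀ x : (W.baseChange K).toAffine.Point, p • x = 0 → x = 0 := fun x hx ↦ by
      have hmem : x ∈ AddSubgroup.torsionBy (W.baseChange K).toAffine.Point ((p : ℕ) : ℤ) := by
        rw [mem_torsionBy_iff, natCast_zsmul]
        exact hx
      rw [hbot] at hmem
      exact hmem
    exact shaIndexBound_sharp_of_globalDivisibility hMcU W p hp2 K hmult hρ hK h3 h4 hHN Dt H.β ι d₁ P
      hPd hPinf hrank hiv hJW
  -- the twist: transports (no (ram) needed) and the X11a lower half at its minimal model, in print shape
  have hD0 : (NumberField.discr K : ℚ) ≠ 0 := by exact_mod_cast NumberField.discr_ne_zero K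
  haveI hEt : (W.quadraticTwist (NumberField.discr K : ℚ)).IsElliptic :=
    W.isElliptic_quadraticTwist hD0
  have hirrd : Wd.HasIrreducibleModPGaloisRep p :=
    hasIrreducibleModPGaloisRep_twist_model W p K hK.1 hirr Cd hWd
  have htam : padicValNat p Wd.tamagawaProduct = padicValNat p W.tamagawaProduct :=
    X2.padicValNat_tamagawaProduct_twist_of_heegner_of_odd W p hp2 K hK hodd hpd hHN Cd hWd
  have hu : padicValRat p (Cd.u : ℚ) = 0 :=
    padicValRat_u_eq_zero_of_twist_minimal W p K hK hHN hmult Cd hWd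
  have hLt' : (W.quadraticTwist (NumberField.discr K : ℚ)).entireLFunction = Wd.entireLFunction := by
    rw [← hWd, entireLFunction_smul]
  have hLd1 : Wd.entireLFunction 1 ≠ 0 := by rw [← hLt']; exact hLt
  have hrd0 : Wd.analyticRank = 0 := (Wd.analyticRank_eq_zero_iff_holds (hmod Wd)).2 hLd1
  have hXa : ClassX11a Wd p := X11b.classX11a_twist_of_not_ram W p hX hnram K hK hHN Cd hWd hrd0
  obtain ⟨qd, hqd, hvqd⟩ :=
    AdditivePotMult.exists_printShape_lower_of_missingLowerBoundAt_rankZero Wd hGZK hrd0 hirrd (hX11a Wd hXa)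
  -- descent to ℚ (x11b3's data-level arithmetic)
  exact missingUpperBoundAt_of_shaIndexBound_sharp W p (W.conductorNorm ℤ) K Dt H ι P (hGZ _ W K)
    (hKo _ W K) hGZK hmod hK hHN hP hp2 hc hμ hr hLt Wd Cd hWd hu htam le_rfl ⟨qd, hqd, hvqd⟩ hU

/-! ### §4 The line's residual S1b (p the ONLY multiplicative prime) from `JetchevMaxHL`(p) + the X11a lower half -/

/-- Place ↔ prime bridge for SPLIT multiplicative reduction (the tree's `hasSplitMultiplicativeReductionAtPrime_iff_hasSplitMultiplicativeReductionAt`,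
with the prime as a variable). [folklore] -/
private theorem hasSplitMultiplicativeReductionAt_of_atPrime (W : WeierstrassCurve ℚ) [W.IsElliptic]
    (v : HeightOneSpectrum (𝓞 ℚ)) (p : ℕ) [Fact p.Prime] (hv : (primesEquiv v : ℕ) = p)
    (h : W.HasSplitMultiplicativeReductionAtPrime p) : W.HasSplitMultiplicativeReductionAt v := by
  subst hv
  exact (hasSplitMultiplicativeReductionAtPrime_iff_hasSplitMultiplicativeReductionAt W v).mp h

/-- **S1b of crux 19715's line `Lines/birth.lean` (registered text of `stub_res_pOnlyMultCarrierAtFive`, binders VERBATIM as conclusion) from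
`JetchevMaxHL`(p) and the X11a lower half at p** (+ the published facts of §3). When `p ≥ 5` is the ONLY multiplicative prime and `E` is split at
`p`, the place of `p` is the unique split multiplicative place, so it carries all of `ord_p ∏c` (corner-p1's
`CornerLocal.padicValNat_tamagawaNumberAt_eq_of_unique_split`): a mono-carrier pair, and §3 applies. The binders `p ∣ ∏c` and `p ∣ ord_p Δ_min` of
S1b are not used. CONDITIONAL (as §3); nothing booked; 19715 NOT closed. [cite: Jetchev2008, Thm. 1.4 (p. 812)] [cite: SilvermanATAEC1994, Cor. IV.9.2 (d)]
[cite: Miller2011LMS, Def. 1.1] -/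
theorem res_pOnlyMultCarrierAtFive_of_jetchevMaxHL_of_lowerX11a
    (hGZ : ∀ (N : ℕ) [NeZero N] (W : WeierstrassCurve ℚ) (K : Type) [Field K] [NumberField K],
      gross_zagier N W K)
    (hKo : ∀ (N : ℕ) [NeZero N] (W : WeierstrassCurve ℚ) (K : Type) [Field K] [NumberField K],
      kolyvagin N W K)
    (hGZK : rank_eq_analyticRank_of_analyticRank_le_one) (hmod : hasEntireLFunction_rat)
    (hnf : exists_isNewformOf) (hHL : HoffsteinLuo1997_exists_twist_L_one_ne_zero)
    (hMaz : mazur_not_dvd_maninConstant_of_odd)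
    (hrec : ∀ (N : ℕ) [NeZero N] (W : WeierstrassCurve ℚ) (K : Type) [Field K] [NumberField K],
      heegnerPointOfConductor_one_galoisConj N W K)
    (hD36 : ∀ (N : ℕ) [NeZero N] (W : WeierstrassCurve ℚ) (K : Type) [Field K] [NumberField K],
      phi_heegnerTau_mem_singularModuliField N W K)
    (hMcU : McCallum1991_padicValNat_card_sha_primary_add_le_of_globalDivisibility)
    (hJmax : ∀ (W : WeierstrassCurve ℚ) [W.IsElliptic] [W.IsGloballyMinimal] (p : ℕ) [Fact p.Prime]
      [NeZero (W.conductorNorm ℤ)] (K : Type) [Field K] [NumberField K]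
      (Dt : ModularParametrizationData W (W.conductorNorm ℤ)) (β : ℤ) (ι : K →+* ℂ),
      5 ≤ p → W.analyticRank = 1 → W.HasMultiplicativeReductionAtPrime p → Surj W p →
      IsImaginaryQuadratic K → SatisfiesHeegnerHypothesis (W.conductorNorm ℤ) K →
      Odd (NumberField.discr K) → NumberField.discr K < -4 →
      (W.quadraticTwist (NumberField.discr K : ℚ)).entireLFunction 1 ≠ 0 →
      (4 * (W.conductorNorm ℤ : ℤ)) ∣ β ^ 2 - NumberField.discr K → ¬ (p : ℤ) ∣ Dt.c →
      ∀ (v : HeightOneSpectrum (𝓞 ℚ)) (s : ℕ), s ≤ padicValNat p (W.tamagawaNumberAt v) →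
        ∀ (n : ℕ) (d : KolyvaginHeegnerData Dt β ι n), Squarefree n →
          (∀ ℓ ∈ n.primeFactors, Zhang2014.IsKolyvaginPrime (W.conductorNorm ℤ) W K p ℓ ∧
            s ≤ Zhang2014.kolyvaginIndex W p ℓ) → PDiv d p s)
    (hX11a : ∀ (Wd : WeierstrassCurve ℚ) [Wd.IsElliptic] [Wd.IsGloballyMinimal] (p : ℕ) [Fact p.Prime],
      ClassX11a Wd p → Typed.MissingLowerBoundAt Wd p) :
    ∀ (W : WeierstrassCurve ℚ) [W.IsElliptic] [W.IsGloballyMinimal] (p : ℕ) [Fact p.Prime],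
      Summit.BirchSwinnertonDyer.Rank1Residual.ClassX11b W p → 5 ≤ p →
      Literature.NumberTheory.EllipticCurves.Rank1Residual.Surj W p →
      ¬ Literature.NumberTheory.EllipticCurves.Rank1Residual.Ram W p → p ∣ W.tamagawaProduct →
      (∀ (ℓ : ℕ) [Fact ℓ.Prime], W.HasMultiplicativeReductionAtPrime ℓ → ℓ = p) →
      W.HasSplitMultiplicativeReductionAtPrime p → p ∣ padicValInt p W.minimalDiscriminantInt →
      Literature.NumberTheory.EllipticCurves.Rank1Residual.Typed.MissingUpperBoundAt W p := by
  intro W _ _ p _ hX hp5 hρ hnram _ honly hsplit _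
  have hp : p.Prime := Fact.out
  have hp2 : p ≠ 2 := by omega
  -- the place of p is the UNIQUE split multiplicative place
  set v₀ : HeightOneSpectrum (𝓞 ℚ) := (primesEquiv (R := 𝓞 ℚ)).symm ⟨p, hp⟩ with hv₀_def
  have hv₀ : (primesEquiv v₀ : ℕ) = p := by rw [hv₀_def, Equiv.apply_symm_apply]
  have hs₀ : W.HasSplitMultiplicativeReductionAt v₀ :=
    hasSplitMultiplicativeReductionAt_of_atPrime W v₀ p hv₀ hsplit
  have huniq : ∀ v, W.HasSplitMultiplicativeReductionAt v → v = v₀ := by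
    intro v hv
    haveI : Fact (primesEquiv v : ℕ).Prime := ⟨(primesEquiv v).2⟩
    have hmv : W.HasMultiplicativeReductionAtPrime (primesEquiv v : ℕ) :=
      (hasMultiplicativeReductionAtPrime_primesEquiv_iff_holds W v (primesEquiv v : ℕ) rfl).mpr
        hv.hasMultiplicativeReductionAt
    have hq : (primesEquiv v : ℕ) = p := honly _ hmv
    apply (primesEquiv (R := 𝓞 ℚ)).injective
    rw [hv₀_def, Equiv.apply_symm_apply]
    exact Subtype.ext hq
  have hmono : ∃ v : HeightOneSpectrum (𝓞 ℚ),
      padicValNat p W.tamagawaProduct ≤ padicValNat p (W.tamagawaNumberAt v) :=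
    ⟨v₀, (CornerLocal.padicValNat_tamagawaNumberAt_eq_of_unique_split W p hp5 hs₀ huniq).ge⟩
  exact missingUpperBoundAt_of_classX11b_of_surj_of_not_ram_of_monoCarrier_of_jetchevMaxHL_of_lowerX11a hGZ hKo hGZK
    hmod hnf hHL hMaz hrec hD36 hMcU p hp2
    (fun V _ _ _ K _ _ Dt β ι ↦ hJmax V p K Dt β ι hp5) (fun Wd _ _ hXa ↦ hX11a Wd p hXa) W hX hρ hnram hmono

end Summit.BirchSwinnertonDyer.BirchSwinnertonDyer.Theorems.JetchevMaxHLAtP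

end
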